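import Summits.Ventures.PercRepro.ProfileGapMonoTwoRowLevels

/-!
# PercRepro — THE CO-RANK-2 ROW `Π⁻_{2,u}` FOR EVERY FINITE MATROID AT EVERY LEVEL (p10, gen 8; part 2 of 2)

Part 1 (ProfileGapMonoTwoRowLevels) settled every level except `u = ρ(E) − 1` on a simple matroid WITH a coloop.
Here, at a coloop `x` and the level `u = ρ(E) − 1 ≥ 3`, the co-rank-2 row of `M` reduces to the co-rank-2 row of
`N := M ∖ x` (of rank `u`) at the level `u − 1` — the row of `N` at its own top-but-one level — plus two complement
injections:

* a rank-2 set `B ∌ x` has `demand_M(B) = demand_N^{(u−1)}(B) + C(u,2)·[ρ_N(E∖x∖B) = u] + (u−1)·[ρ_N(E∖x∖B) = u−1]`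
  (Pascal at the two thresholds, `demand_two_coloop_eq`); a rank-2 set through `x` is `x ∪ B'` with `B'` a
  rank-1 set of `N` and has demand `C(u,2)·[E∖x∖B' spans N]` (`sum_demand_two_coloop_mem`);
* the supply `W⁻_{2,u}(M)` contains disjointly the co-rank-1 sets of `N` at level `u` and the co-rank-2 sets of `N`
  at level `u − 1` with `x` inserted (`card_levelSetCoQ_two_coloop_ge`);
* `B ↦ E∖x∖B` pays the new terms: the rank-2 and rank-1 sets with spanning complement land in `W⁻_{1,u}(N)`, the
  rank-2 sets with complement of rank `u − 1` in `W⁻_{2,u−1}(N)`; with `C(u,2) = C(u−1,2) + (u−1)` the row of `N`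
  closes the count (`profileIneqMinusQ_two_of_coloop`).

The assembly is a strong induction on `#E` with the level `u` universally quantified inside
(`profileIneqMinusQ_two_all_aux`), because the coloop step changes the level; loops and parallel pairs go through
`gapMonoQ_of_loop` / `gapMonoQ_of_parallel` (the latter on the co-rank-1 row `profileIneqMinusQ_one_all`).

**THEOREM** `profileIneqMinusQ_two_all (M) (u) (hu : 2 ≤ u) : ProfileIneqMinusQ M 2 u` — the co-rank-2 row of the
profile family on every finite matroid at every level.  CONSEQUENCES (ProfileGapMonoHardThree): the hard rule of
`c025_of_hardRuleQ'` is needed only for `q ≥ 3`, and `gapMonoQ_of_generic'` at `q = 3` is unconditional.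

* `rk_singleton_of_coloop`, `indep_singleton_of_coloop`, `rk_gr_delete_coloop`, `demand_two_coloop_eq`,
  `sum_demand_two_coloop_notMem`, `sum_demand_two_coloop_mem`, `card_levelSetCoQ_two_coloop_ge`,
  **`profileIneqMinusQ_two_of_coloop`**;
* `profileIneqMinusQ_two_all_aux`, **`profileIneqMinusQ_two_all`**, `profileIneq_two_all_of_minusQ`.
-/

open scoped Matroid

namespace PercRepro.Cogirth

open Finset ThmH Skew Shadow Profile

variable {α : Type} [DecidableEq α] {M : Matroid α} [M.Finite]

/-! ### The coloop step at the level `u = ρ(E) − 1` -/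

/-- A coloop is a non-loop: `ρ({x}) = 1`. -/
theorem rk_singleton_of_coloop {x : α} (hx : x ∈ gr M) (hxc : rk M ((gr M).erase x) + 1 = rk M (gr M)) :
    rk M {x} = 1 := by
  have h := rk_erase_of_coloop hx hxc (X := {x}) (singleton_subset_iff.2 hx) (mem_singleton_self x)
  rw [erase_singleton] at h
  have h0 : rk M (∅ : Finset α) = 0 := by
    unfold rk
    simp
  omega

/-- A coloop is independent. -/
theorem indep_singleton_of_coloop {x : α} (hx : x ∈ gr M) (hxc : rk M ((gr M).erase x) + 1 = rk M (gr M)) :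
    M.Indep {x} := by
  have h := indep_of_rk_eq_card (M := M) (X := {x}) (by rw [card_singleton]; exact rk_singleton_of_coloop hx hxc)
  rwa [coe_singleton] at h

/-- The deletion of a coloop has rank one less. -/
theorem rk_gr_delete_coloop {x : α} (hxc : rk M ((gr M).erase x) + 1 = rk M (gr M)) :
    rk (M ＼ ({x} : Set α)) (gr (M ＼ ({x} : Set α))) + 1 = rk M (gr M) := by
  rw [gr_delete', rk_delete (Subset.refl _)]
  exact hxc

/-- **The demand of a rank-2 set avoiding a coloop `x`** at the level `u = ρ(E) − 1`, in terms of
`N = M ∖ x` (of rank `u`) at the level `u − 1`: with `r := ρ_N(E ∖ x ∖ B) ≤ u`,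
`demand_M(B) = demand_N^{(u−1)}(B) + C(u,2) · [r = u] + (u − 1) · [r = u − 1]` (Pascal at the two thresholds). -/
theorem demand_two_coloop_eq {x : α} (hx : x ∈ gr M) (hxc : rk M ((gr M).erase x) + 1 = rk M (gr M))
    {u : ℕ} (hu : 3 ≤ u) (hR : u + 1 = rk M (gr M)) {B : Finset α} (hB : B ∈ Rq (M ＼ ({x} : Set α)) 2) :
    demand M 2 u B = demand (M ＼ ({x} : Set α)) 2 (u - 1) B +
      (if rk (M ＼ ({x} : Set α)) (gr (M ＼ ({x} : Set α)) \ B) = u then u.choose 2 else 0) +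
      (if rk (M ＼ ({x} : Set α)) (gr (M ＼ ({x} : Set α)) \ B) = u - 1 then u - 1 else 0) := by
  have hBg : B ⊆ (gr M).erase x := by
    have := (mem_Rq.1 hB).1
    rwa [gr_delete'] at this
  have hxB : x ∉ B := fun h => (mem_erase.1 (hBg h)).1 rfl
  have hcol : rk M ((gr M \ B).erase x) + 1 = rk M (gr M \ B) :=
    rk_erase_of_coloop hx hxc sdiff_subset (mem_sdiff.2 ⟨hx, hxB⟩)
  have hr : rk (M ＼ ({x} : Set α)) (gr (M ＼ ({x} : Set α)) \ B) = rk M ((gr M \ B).erase x) := by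
    rw [gr_delete', rk_delete sdiff_subset, erase_sdiff]
  have hrle : rk M ((gr M \ B).erase x) ≤ u := by
    have h1 : rk M ((gr M \ B).erase x) ≤ rk M ((gr M).erase x) :=
      rk_mono_sub (erase_subset_erase x sdiff_subset)
    omega
  rw [hr, demand_delete_eq_ite']
  unfold demand
  rw [← hcol]
  rcases (show rk M ((gr M \ B).erase x) = u ∨ rk M ((gr M \ B).erase x) = u - 1 ∨
      rk M ((gr M \ B).erase x) + 2 ≤ u by omega) with h | h | h
  · rw [h, if_pos (by omega), if_pos (by omega), if_pos rfl, if_neg (by omega), add_zero]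
    have e1 : (u + 1).choose (u - 2) = u.choose 2 + u.choose 3 := by
      rw [show u - 2 = u + 1 - 3 by omega, Nat.choose_symm (by omega)]
      exact Nat.choose_succ_succ' u 2
    have e2 : u.choose (u - 1 - 2) = u.choose 3 := by
      rw [show u - 1 - 2 = u - 3 by omega]
      exact Nat.choose_symm (by omega)
    rw [e1, e2]
    ring
  · rw [h, show u - 1 + 1 = u by omega, if_pos (le_refl _), if_pos (le_refl _), if_neg (by omega), if_pos rfl,
      add_zero]
    have e1 : u.choose (u - 2) = u.choose 2 := Nat.choose_symm (by omega)
    have e2 : (u - 1).choose (u - 1 - 2) = (u - 1).choose 2 := Nat.choose_symm (by omega)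
    have e3 : u.choose 2 = (u - 1).choose 1 + (u - 1).choose 2 := by
      have h := Nat.choose_succ_succ' (u - 1) 1
      rwa [show u - 1 + 1 = u by omega, show (1 : ℕ) + 1 = 2 by rfl] at h
    rw [e1, e2, e3, Nat.choose_one_right]
    ring
  · rw [if_neg (by omega), if_neg (by omega), if_neg (by omega), if_neg (by omega)]

/-- The demand sum over the rank-2 sets avoiding a coloop `x`, split by the two thresholds. -/
theorem sum_demand_two_coloop_notMem {x : α} (hx : x ∈ gr M) (hxc : rk M ((gr M).erase x) + 1 = rk M (gr M))
    {u : ℕ} (hu : 3 ≤ u) (hR : u + 1 = rk M (gr M)) :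
    ∑ B ∈ Rq (M ＼ ({x} : Set α)) 2, demand M 2 u B =
      ∑ B ∈ Rq (M ＼ ({x} : Set α)) 2, demand (M ＼ ({x} : Set α)) 2 (u - 1) B +
      u.choose 2 * ((Rq (M ＼ ({x} : Set α)) 2).filter
        (fun B => rk (M ＼ ({x} : Set α)) (gr (M ＼ ({x} : Set α)) \ B) = u)).card +
      (u - 1) * ((Rq (M ＼ ({x} : Set α)) 2).filter
        (fun B => rk (M ＼ ({x} : Set α)) (gr (M ＼ ({x} : Set α)) \ B) = u - 1)).card := by
  rw [sum_congr rfl (fun B hB => demand_two_coloop_eq hx hxc hu hR hB), sum_add_distrib, sum_add_distrib,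
    ← sum_filter, ← sum_filter, sum_const, sum_const, smul_eq_mul, smul_eq_mul, mul_comm _ (u.choose 2),
    mul_comm _ (u - 1)]

/-- The demand sum over the rank-2 sets through a coloop `x` at the level `u = ρ(E) − 1`: each is `x ∪ B'` with
`B'` a rank-1 set of `N = M ∖ x`, and its demand is `C(u,2)` exactly when `E ∖ x ∖ B'` spans `N`. -/
theorem sum_demand_two_coloop_mem {x : α} (hx : x ∈ gr M) (hxc : rk M ((gr M).erase x) + 1 = rk M (gr M))
    {u : ℕ} (hu : 3 ≤ u) (hR : u + 1 = rk M (gr M)) :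
    ∑ B ∈ (Rq M 2).filter (fun B => x ∈ B), demand M 2 u B =
      u.choose 2 * ((Rq (M ＼ ({x} : Set α)) 1).filter
        (fun B' => rk (M ＼ ({x} : Set α)) (gr (M ＼ ({x} : Set α)) \ B') = u)).card := by
  have hxI : M.Indep {x} := indep_singleton_of_coloop hx hxc
  have hxcol : M.IsColoop x := by
    rw [Matroid.isColoop_iff_notMem_closure_compl (by rw [← coe_gr]; exact_mod_cast hx)]
    intro h
    have h' : x ∈ clF M ((gr M).erase x) := by
      rw [← mem_coe, coe_clF, coe_erase, coe_gr]
      exact h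
    rw [mem_clF_iff_rk_insert_eq hx (erase_subset _ _), insert_erase hx] at h'
    omega
  have hcd : (M ／ ({x} : Set α)) = M ＼ ({x} : Set α) :=
    Matroid.contract_eq_delete_of_subset_coloops (by rw [Set.singleton_subset_iff]; exact hxcol)
  have hN : rk (M ＼ ({x} : Set α)) (gr (M ＼ ({x} : Set α))) = u := by
    have h := rk_gr_delete_coloop hxc
    rw [← hR] at h
    omega
  rw [sum_Rq_filter_mem_contract hxI (by norm_num : 1 ≤ 2) (demand M 2 u)]
  simp only [hcd]
  have hterm : ∀ B' ∈ Rq (M ＼ ({x} : Set α)) (2 - 1), demand M 2 u (insert x B') =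
      if rk (M ＼ ({x} : Set α)) (gr (M ＼ ({x} : Set α)) \ B') = u then u.choose 2 else 0 := by
    intro B' hB'
    have hB'g : B' ⊆ (gr M).erase x := by
      have := (mem_Rq.1 hB').1
      rwa [gr_delete'] at this
    have hset : gr M \ insert x B' = (gr M).erase x \ B' := by
      ext w
      simp only [mem_sdiff, mem_insert, mem_erase, not_or]
      tauto
    have hr : rk (M ＼ ({x} : Set α)) (gr (M ＼ ({x} : Set α)) \ B') = rk M (gr M \ insert x B') := by
      rw [gr_delete', rk_delete sdiff_subset, hset]
    have hrle : rk M (gr M \ insert x B') ≤ u := by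
      rw [← hr, ← hN]
      exact rk_mono_sub sdiff_subset
    unfold demand
    rw [hr]
    by_cases h : rk M (gr M \ insert x B') = u
    · rw [if_pos h, if_pos (by omega), h, Nat.choose_symm (by omega : 2 ≤ u)]
    · rw [if_neg h, if_neg (by omega)]
  rw [sum_congr rfl hterm, ← sum_filter, sum_const, smul_eq_mul, mul_comm]

/-- **The supply at a coloop `x`**, level `u = ρ(E) − 1`: the rank-`u` sets of `N = M ∖ x` with nonempty-rank
complement (they have co-rank `≥ 2` in `M`, the coloop added) and the co-rank-2 sets of `N` at level `u − 1`
(with `x` inserted) lie disjointly in `W⁻_{2,u}(M)`. -/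
theorem card_levelSetCoQ_two_coloop_ge {x : α} (hx : x ∈ gr M) (hxc : rk M ((gr M).erase x) + 1 = rk M (gr M))
    {u : ℕ} (hu : 3 ≤ u) :
    (levelSetCoQ (M ＼ ({x} : Set α)) 1 u).card + (levelSetCoQ (M ＼ ({x} : Set α)) 2 (u - 1)).card ≤
      (levelSetCoQ M 2 u).card := by
  have hmaps1 : ∀ S ∈ levelSetCoQ (M ＼ ({x} : Set α)) 1 u, S ∈ levelSetCoQ M 2 u := by
    intro S hS
    rw [mem_levelSetCoQ, gr_delete'] at hS
    obtain ⟨⟨hS1, hS2⟩, hS3⟩ := hS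
    have hxS : x ∉ S := fun h => (mem_erase.1 (hS1 h)).1 rfl
    rw [mem_levelSetCoQ]
    refine ⟨⟨hS1.trans (erase_subset _ _), ?_⟩, ?_⟩
    · rw [← coe_rk] at hS2 ⊢
      rw [rk_delete hS1] at hS2
      exact hS2
    · have hcol := rk_erase_of_coloop hx hxc (X := gr M \ S) sdiff_subset (mem_sdiff.2 ⟨hx, hxS⟩)
      rw [rk_delete sdiff_subset, erase_sdiff] at hS3
      omega
  have hmaps2 : ∀ S' ∈ levelSetCoQ (M ＼ ({x} : Set α)) 2 (u - 1), insert x S' ∈ levelSetCoQ M 2 u := by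
    intro S' hS'
    rw [mem_levelSetCoQ, gr_delete'] at hS'
    obtain ⟨⟨hS1, hS2⟩, hS3⟩ := hS'
    have hxS : x ∉ S' := fun h => (mem_erase.1 (hS1 h)).1 rfl
    have hSg : S' ⊆ gr M := hS1.trans (erase_subset _ _)
    have hr : rk M S' = u - 1 := by
      have h : rk (M ＼ ({x} : Set α)) S' = u - 1 := by
        rw [← coe_rk] at hS2
        exact_mod_cast hS2
      rwa [rk_delete hS1] at h
    have hins := rk_erase_of_coloop hx hxc (X := insert x S') (insert_subset hx hSg) (mem_insert_self x S')
    rw [erase_insert hxS] at hins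
    rw [mem_levelSetCoQ]
    refine ⟨⟨insert_subset hx hSg, ?_⟩, ?_⟩
    · rw [← coe_rk]
      congr 1
      omega
    · have hset : gr M \ insert x S' = (gr M).erase x \ S' := by
        ext w
        simp only [mem_sdiff, mem_insert, mem_erase, not_or]
        tauto
      rw [hset, ← rk_delete sdiff_subset]
      exact hS3
  have hinj : Set.InjOn (fun S' => insert x S') (levelSetCoQ (M ＼ ({x} : Set α)) 2 (u - 1) : Set (Finset α)) := by
    intro S₁ h₁ S₂ h₂ heq
    have hz : ∀ S' ∈ levelSetCoQ (M ＼ ({x} : Set α)) 2 (u - 1), x ∉ S' := by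
      intro S' hS'
      rw [mem_levelSetCoQ, gr_delete'] at hS'
      exact fun h => (mem_erase.1 (hS'.1.1 h)).1 rfl
    have hz₁ := hz S₁ h₁
    have hz₂ := hz S₂ h₂
    simp only at heq
    have := congrArg (fun T => T.erase x) heq
    simp only [erase_insert hz₁, erase_insert hz₂] at this
    exact this
  have hdisj : Disjoint (levelSetCoQ (M ＼ ({x} : Set α)) 1 u)
      ((levelSetCoQ (M ＼ ({x} : Set α)) 2 (u - 1)).image (fun S' => insert x S')) := by
    rw [disjoint_left]
    intro S hS hS'
    rw [mem_image] at hS'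
    obtain ⟨S', _, rfl⟩ := hS'
    rw [mem_levelSetCoQ, gr_delete'] at hS
    exact (mem_erase.1 (hS.1.1 (mem_insert_self x S'))).1 rfl
  have hcard := card_le_card (union_subset (fun S hS => hmaps1 S hS)
    (fun S hS => by rw [mem_image] at hS; obtain ⟨S', hS', rfl⟩ := hS; exact hmaps2 S' hS'))
  rw [card_union_of_disjoint hdisj, card_image_of_injOn hinj] at hcard
  exact hcard

/-- **THE COLOOP STEP**: at a coloop `x` and the level `u = ρ(E) − 1 ≥ 3`, the co-rank-2 row of `M` follows from
the co-rank-2 row of `M ∖ x` at the level `u − 1` (its own top-but-one level) and the complement injections. -/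
theorem profileIneqMinusQ_two_of_coloop {x : α} (hx : x ∈ gr M) (hxc : rk M ((gr M).erase x) + 1 = rk M (gr M))
    {u : ℕ} (hu : 3 ≤ u) (hR : u + 1 = rk M (gr M))
    (hdel : ProfileIneqMinusQ (M ＼ ({x} : Set α)) 2 (u - 1)) : ProfileIneqMinusQ M 2 u := by
  unfold ProfileIneqMinusQ at hdel ⊢
  rw [← sum_filter_add_sum_filter_not (Rq M 2) (fun B => x ∈ B), sum_demand_two_coloop_mem hx hxc hu hR,
    show (Rq M 2).filter (fun B => ¬ x ∈ B) = Rq (M ＼ ({x} : Set α)) 2 from (Rq_delete_eq_filter x 2).symm,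
    sum_demand_two_coloop_notMem hx hxc hu hR]
  have hsup := card_levelSetCoQ_two_coloop_ge hx hxc hu
  have hAP := card_filter_Rq_two_add_one_le_card_levelSetCoQ (M ＼ ({x} : Set α)) u
  have hA' := card_filter_Rq_le_card_levelSetCoQ (M ＼ ({x} : Set α)) 2 (u - 1)
  have hC : u.choose 2 = (u - 1).choose 2 + (u - 1) := by
    have h := Nat.choose_succ_succ' (u - 1) 1
    rw [show u - 1 + 1 = u by omega, Nat.choose_one_right, show (1 : ℕ) + 1 = 2 by rfl] at h
    omega
  set D := ∑ B ∈ Rq (M ＼ ({x} : Set α)) 2, demand (M ＼ ({x} : Set α)) 2 (u - 1) B with hD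
  set A := ((Rq (M ＼ ({x} : Set α)) 2).filter
    (fun B => rk (M ＼ ({x} : Set α)) (gr (M ＼ ({x} : Set α)) \ B) = u)).card with hA
  set A' := ((Rq (M ＼ ({x} : Set α)) 2).filter
    (fun B => rk (M ＼ ({x} : Set α)) (gr (M ＼ ({x} : Set α)) \ B) = u - 1)).card with hA'def
  set P := ((Rq (M ＼ ({x} : Set α)) 1).filter
    (fun B' => rk (M ＼ ({x} : Set α)) (gr (M ＼ ({x} : Set α)) \ B') = u)).card with hP
  set W₁ := (levelSetCoQ (M ＼ ({x} : Set α)) 1 u).card with hW₁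
  set W₂ := (levelSetCoQ (M ＼ ({x} : Set α)) 2 (u - 1)).card with hW₂
  set L := (levelSetCoQ M 2 u).card with hL
  calc u.choose 2 * P + (D + u.choose 2 * A + (u - 1) * A')
      ≤ u.choose 2 * P + ((u - 1).choose 2 * W₂ + u.choose 2 * A + (u - 1) * W₂) := by
        apply Nat.add_le_add_left
        apply Nat.add_le_add (Nat.add_le_add_right hdel _) (Nat.mul_le_mul_left _ hA')
    _ = u.choose 2 * (A + P) + ((u - 1).choose 2 + (u - 1)) * W₂ := by ring
    _ = u.choose 2 * (A + P + W₂) := by rw [← hC]; ring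
    _ ≤ u.choose 2 * (W₁ + W₂) := Nat.mul_le_mul_left _ (by omega)
    _ ≤ u.choose 2 * L := Nat.mul_le_mul_left _ hsup

/-! ### The assembly -/

/-- **The co-rank-2 row at every level, by strong induction on `#E`** (the level `u` free inside). -/
theorem profileIneqMinusQ_two_all_aux (n : ℕ) :
    ∀ (K : Matroid α) [K.Finite], (gr K).card = n → ∀ u : ℕ, 2 ≤ u → ProfileIneqMinusQ K 2 u := by
  induction n using Nat.strong_induction_on with
  | _ n ih =>
    intro K _ hn u hu
    -- the diagonal `u = 2`
    rcases Nat.eq_or_lt_of_le hu with hu2 | hu3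
    · rw [← hu2]
      exact profileIneqMinusQ_self K 2
    -- the row of `K ∖ z` at any level is the induction hypothesis
    have hIH : ∀ z ∈ gr K, ∀ v : ℕ, 2 ≤ v → ProfileIneqMinusQ (K ＼ ({z} : Set α)) 2 v := by
      intro z hz v hv
      have hcard : (gr (K ＼ ({z} : Set α))).card = n - 1 := by
        rw [gr_delete', card_erase_of_mem hz, hn]
      have hlt : n - 1 < n := by
        have := card_pos.2 ⟨z, hz⟩
        omega
      exact ih (n - 1) hlt _ hcard v hv
    -- a loop
    by_cases hl : ∃ ℓ ∈ gr K, rk K {ℓ} = 0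
    · obtain ⟨ℓ, hℓ, h0⟩ := hl
      exact profileIneqMinusQ_of_gapMonoQ (gapMonoQ_of_loop hℓ h0 (hIH ℓ hℓ u hu)) (hIH ℓ hℓ u hu)
    push Not at hl
    have h1 : ∀ x ∈ gr K, rk K {x} = 1 := by
      intro x hx
      have := rk_le_card (M := K) ({x} : Finset α)
      rw [card_singleton] at this
      have := hl x hx
      omega
    -- a parallel pair
    by_cases hp : ∃ z ∈ gr K, ∃ z' ∈ gr K, z ≠ z' ∧ rk K {z, z'} = 1
    · obtain ⟨z, hz, z', hz', hzz', hpar⟩ := hp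
      have hdel : ProfileIneqMinusQ ((K ＼ ({z} : Set α)) ／ ({z'} : Set α)) (2 - 1) (u - 1) :=
        profileIneqMinusQ_one_all _ (by omega)
      exact profileIneqMinusQ_of_gapMonoQ
        (gapMonoQ_of_parallel hz hz' hzz' (h1 z hz) (h1 z' hz') hpar (by norm_num) hu3 hdel) (hIH z hz u hu)
    push Not at hp
    have h2 : ∀ x ∈ gr K, ∀ y ∈ gr K, x ≠ y → rk K {x, y} = 2 := by
      intro x hx y hy hxy
      have hle := rk_le_card (M := K) ({x, y} : Finset α)
      rw [card_pair hxy] at hle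
      have hge : rk K {x} ≤ rk K {x, y} := rk_mono_sub (by simp)
      have hne := hp x hx y hy hxy
      have := h1 x hx
      omega
    have hs : Simple' K := simple'_of_rk_one_two h1 h2
    -- the level split
    by_cases hR1 : u + 2 ≤ rk K (gr K)
    · exact profileIneqMinusQ_two_of_le_rk hu3 hR1
    by_cases hR2 : rk K (gr K) < u
    · exact profileIneqMinusQ_of_rk_lt hR2
    by_cases hR3 : rk K (gr K) = u
    · exact profileIneqMinusQ_top (by omega) hR3
    have hR : u + 1 = rk K (gr K) := by omega
    -- the level `u = ρ(E) − 1`: a coloop, or none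
    by_cases hcol : ∃ x ∈ gr K, rk K ((gr K).erase x) + 1 = rk K (gr K)
    · obtain ⟨x, hx, hxc⟩ := hcol
      exact profileIneqMinusQ_two_of_coloop hx hxc hu3 hR (hIH x hx (u - 1) (by omega))
    push Not at hcol
    have hnc : ∀ x ∈ gr K, rk K ((gr K).erase x) = rk K (gr K) := by
      intro x hx
      have hle : rk K ((gr K).erase x) ≤ rk K (gr K) := rk_mono_sub (erase_subset _ _)
      have hge : rk K (gr K) ≤ rk K ((gr K).erase x) + 1 := by
        have := rk_insert_le (M := K) x ((gr K).erase x)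
        rwa [insert_erase hx] at this
      have := hcol x hx
      omega
    exact profileIneqMinusQ_two_of_no_coloop hs hnc hu3 hR

/-- **THEOREM — THE CO-RANK-2 ROW OF THE PROFILE FAMILY HOLDS ON EVERY FINITE MATROID AT EVERY LEVEL**:
`D₂(M; u) ≤ C(u,2) · #{S : ρ(S) = u, ρ(E ∖ S) ≥ 2}` for every `u ≥ 2`. -/
theorem profileIneqMinusQ_two_all (M : Matroid α) [M.Finite] (u : ℕ) (hu : 2 ≤ u) : ProfileIneqMinusQ M 2 u :=
  profileIneqMinusQ_two_all_aux _ M rfl u hu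

/-- The plain row `q = 2` once more, now from the co-rank form. -/
theorem profileIneq_two_all_of_minusQ (M : Matroid α) [M.Finite] (u : ℕ) (hu : 2 ≤ u) : ProfileIneq M 2 u :=
  profileIneq_of_minusQ hu (profileIneqMinusQ_two_all M u hu)

end PercRepro.Cogirth
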